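import Summits.NavierStokesRegularity.NavierStokesRegularity.Theorems.CoriolisHeadNoCoRotatingCoreOfLiouvilleConjectures
import Literature.Analysis.FluidPDE.PineauVicolRSSHolds
import HarnessLib

/-!
# CoriolisHeadNoCoRotatingCoreDSSWindow — crux `NoCoRotatingCore` (stmt-NavierStokesRegularity-22676):
# per Type-I constant `K`, the crux needs the Type-I DSS Liouville wall only on a COMPACT WINDOW of factors

Support file (`--supports stmt-NavierStokesRegularity-22676 --as helper`; theorems only).  Sharpening of the edge
`noCoRotatingCore_of_typeIDSSLiouvilleConjecture` (22676 ⟸ Type-I DSS Liouville wall): by Pineau–Vicol's Theorem 1.4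
(`pineauVicol2026_rss_liouville_holds`, DISCHARGED in the tree) profiles at rates `|α| < α₁(K)` or `|α| > α₂(K)` vanish
unconditionally, and a profile at a window rate `α₁(K) ≤ |α| ≤ α₂(K)` is `e^{π/|α|}`-DSS with
`e^{π/|α|} ∈ [e^{π/α₂(K)}, e^{π/α₁(K)}]`.  Hence (`pineauVicolConjecture_of_typeIDSSLiouville_window`): for every `K > 0`
there are `1 < c₁ ≤ c₂` such that the UNROTATED Type-I DSS Liouville statements `TypeIDSSLiouville c` for the factors
`c ∈ [c₁, c₂]` alone imply Pineau–Vicol's Conjecture 1.1 (profile form) for all profiles with decay constant `K` and all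
`α ≠ 0` — the exact slice of the wall (Bradshaw–Tsai OP 5.1 / Tsai Conj. 8.8) on which crux 22676 (⟺ Conj. 1.1,
`noCoRotatingCore_iff_pineauVicolConjecture`) hangs.

HONEST FRAMING.  A conditional bridge; the wall on `[c₁, c₂]`, `NoCoRotatingCore`, Conjecture 1.1 and NS regularity are
NOT proved; `c₁(K), c₂(K)` are as ineffective as Pineau–Vicol's / Chae–Wolf's thresholds in the tree (compactness).

References: B. Pineau, V. Vicol, arXiv:2607.09619 (2026), Thm 1.4, Remark 1.5 [PineauVicol2026]; Z. Bradshaw,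
T.-P. Tsai, Comm. PDE 42 (2017) §5 OP 5.1 [BradshawTsai2017CPDE].
-/

noncomputable section

-- the summit and its single sub-problem share the name (CONVENTIONS §1), as in every Theorems file
set_option linter.dupNamespace false

open Set Function Filter MeasureTheory
open Literature.Analysis.FluidPDE Literature.Analysis.FluidPDE.PineauVicol2026
open Summit.NavierStokesRegularity.NavierStokesRegularity.Theses
open scoped RealInnerProductSpace Laplacian ContDiff Topology

namespace Summit.NavierStokesRegularity.NavierStokesRegularity.Theorems.CoriolisHead

/-- **The DSS-wall window of crux 22676.**  For every `K > 0` there are factors `1 < c₁ ≤ c₂` (namely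
`c₁ = e^{π/α₂(K)}`, `c₂ = max(e^{π/α₁(K)}, e^{π/α₂(K)})` with Pineau–Vicol's thresholds) such that: IF the unrotated
Type-I DSS Liouville statement `TypeIDSSLiouville c` holds for every `c ∈ [c₁, c₂]`, THEN every smooth solution `(U, P)`
of the Pineau–Vicol-frame profile system at any rate `α ≠ 0` with `‖U(y)‖ ≤ K/(1+‖y‖)` vanishes.  Outside the window
this is Theorem 1.4 (`pineauVicol2026_rss_liouville_holds`); inside, `pineauVicolConjecture_of_typeIDSSLiouville` at the
factor `e^{π/|α|} ∈ [c₁, c₂]`.  CONDITIONAL on the wall slice. [cite: PineauVicol2026, Theorem 1.4 and Remark 1.5 (arXiv:2607.09619 pp. 4–6)] -/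
theorem pineauVicolConjecture_of_typeIDSSLiouville_window :
    ∀ K : ℝ, 0 < K → ∃ c₁ c₂ : ℝ, 1 < c₁ ∧ c₁ ≤ c₂ ∧
      ((∀ c : ℝ, c₁ ≤ c → c ≤ c₂ → TypeIDSSLiouville c) →
        ∀ (α : ℝ) (U : EuclideanSpace ℝ (Fin 3) → EuclideanSpace ℝ (Fin 3)) (P : EuclideanSpace ℝ (Fin 3) → ℝ),
          α ≠ 0 → ContDiff ℝ (⊤ : ℕ∞) U → ContDiff ℝ 2 P →
          Literature.Analysis.FluidPDE.VectorCalculus.IsDivFree U →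
          (∀ y, α • (rotGen (U y) - fderiv ℝ U y (rotGen y)) + (1 / 2 : ℝ) • U y
            + (1 / 2 : ℝ) • fderiv ℝ U y y - Laplacian.laplacian U y
            + Literature.Analysis.FluidPDE.convect U U y + gradient P y = 0) →
          (∀ y, ‖U y‖ ≤ K / (1 + ‖y‖)) → ∀ y, U y = 0) := by
  intro K hK
  obtain ⟨α₁, α₂, hα₁, hα₂, H⟩ := pineauVicol2026_rss_liouville_holds K hK
  refine ⟨Real.exp (Real.pi / α₂), max (Real.exp (Real.pi / α₁)) (Real.exp (Real.pi / α₂)),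
    Real.one_lt_exp_iff.2 (div_pos Real.pi_pos hα₂), le_max_right _ _, ?_⟩
  intro hW α U P hα hU hP hdiv heq hdec y
  by_cases hout : |α| < α₁ ∨ α₂ < |α|
  · -- outside the window: Theorem 1.4, unconditionally
    obtain ⟨p, hp⟩ := exists_isClassicalNSSolutionOn_pvAnsatz_of_profile hU hP hdiv heq
    have hsol : IsClassicalNSSolutionOn (Ico (-1) 0) 1 0 (pvAnsatz α (fun y _ => U y)) p :=
      hp.mono (fun t ht => ht.2) (uniqueDiffOn_Ico _ _)
    have hI : ∀ t ∈ Ico (-1 : ℝ) 0, ∀ x : EuclideanSpace ℝ (Fin 3),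
        ‖pvAnsatz α (fun y _ => U y) t x‖ ≤ K / (‖x‖ + Real.sqrt (-t)) :=
      fun t ht x => hasTypeIDecay_pvAnsatz_of_profile (α := α) hdec t ht.2 x
    have h0 := H α _ p U hsol hI (hU.of_le (by norm_cast)) (fun _ _ _ => rfl) hout
    rw [h0]
    rfl
  · -- inside the window: the wall at the factor `e^{π/|α|}`
    push Not at hout
    obtain ⟨h1, h2⟩ := hout
    have hα0 : 0 < |α| := abs_pos.2 hα
    have hlo : Real.exp (Real.pi / α₂) ≤ Real.exp (Real.pi / |α|) :=
      Real.exp_le_exp.2 (div_le_div_of_nonneg_left Real.pi_pos.le hα0 h2)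
    have hhi : Real.exp (Real.pi / |α|) ≤ max (Real.exp (Real.pi / α₁)) (Real.exp (Real.pi / α₂)) :=
      le_max_of_le_left (Real.exp_le_exp.2 (div_le_div_of_nonneg_left Real.pi_pos.le hα₁ h1))
    exact pineauVicolConjecture_of_typeIDSSLiouville hα (hW _ hlo hhi) U P hU hP hdiv heq ⟨K, hdec⟩ y

end Summit.NavierStokesRegularity.NavierStokesRegularity.Theorems.CoriolisHead

end
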